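import Summits.QuantumFields.BalabanUV.Beta.GAN24.FibreBlockSolve

/-!
# `BalabanUV.Beta.GAN24.CapacitanceSolve` — binder row G-an2-4 / (CONV-C), road P1-fibre, node N07′ «global half» of `SKELETON-P1.md` S1b′:
# the ABSTRACT CAPACITANCE REDUCTION of the per-fibre arrow system (leaf P1-L05, part (a): the `L04c`-independent algebra)

NOT IN PRINT; OUR PROOF ATTEMPT.  HONEST FRAMING (cell contract, verbatim): «discharging `BetaPertH` makes Bałaban's UV stability UNCONDITIONAL — a real
constructive-QFT result; it is NOT the continuum limit and NOT the Clay problem.»  HONEST DEPENDENCY (verbatim): «continuum YM on T⁴ ⇐ BetaPertH ∧ nine spine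
estimates (0/9 proved); BetaPertH ⇐ (D1) ∧ (D4) ∧ CAP+tail; G-an2-4 gates asym, D1 and NE2/3/4.»  [folklore] finite-dimensional algebra over `ℂ` (no estimate, no cited
fact, no wall binder, no `def … : Prop` hypothesis: the `[shape]` predicates below carry all their data as parameters and are asserted of nothing).  NOT summit
progress; nothing of (CONV-C)'s K-slot is discharged here.

## What is proved
`GAN24/FibreBlockSolve` (leaf P1-L02) solves ONE diagonal block `T(k_m)` of the arrow form S1a of the Bloch fibre matrix: given the feed `g` and the gauge feed `cc`
of that block, `Asol`/`musol` satisfy its (EL) and (G) rows.  Its header records the consequence left unformalised there: «with these per-momentum formulas the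
global rows (M), (Q) become the (D+1)×(D+1) capacitance system of alias sums — the only non-explicit inverse left in the fibre».  THIS FILE formalises exactly
that consequence, ABSTRACTLY: over an arbitrary alias index `ι` (in S1a: `m ∈ (ℤ/N)^D`, fine momenta `k_m = (p + 2πm)/N`) with per-alias symbols
`dd m = ∂̂(k_m)`, `db m = ∂̂♭(k_m)`, `L m = |∂̂|²(k_m) ≠ 0`, `∂̂♭_m·∂̂_m = L_m`, and ABSTRACT border weights
  `wE m κ` (EL row `(m, κ)`, coefficient of `φ_κ`; in S1a `χ̂(m)·s♭_κ(m)`),   `wG m` (G row `m`, coefficient of `c`; in S1a `χ̂(m)`),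
  `wM m`   (M row, coefficient of `μ̂(m)`; in S1a `S(m)`),                    `wQ m κ` (Q row `κ`, coefficient of `Â_κ(m)`; in S1a `S(m)·s_κ(m)`),
packaged as `Fibre D ι`, the ARROW SYSTEM with sources `(f, γ, ρ, q)` for the unknowns `(A, μ, φ, c)`
  (EL) `2(L_m A_{mκ} − ∂_{mκ}(∂♭_m·A_m)) − L_m ∂_{mκ} μ_m − wE_{mκ} φ_κ = f_{mκ}`,   (G) `L_m (∂♭_m·A_m) − wG_m c = γ_m`,
  (M)  `Σ_m wM_m μ_m = ρ`,                                                        (Q) `Σ_m wQ_{mκ} A_{mκ} = q_κ`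
(`ArrowSolves`) is EQUIVALENT (`arrowSolves_iff`) to: `(φ, c)` solves the `(D+1)×(D+1)` CAPACITANCE SYSTEM (`CapSolves`)
  `Σ_l capP κ l · φ_l + capV κ · c = q_κ − srcQ κ`,     `Σ_κ capW κ · φ_κ = −ρ − srcM`
with the EXPLICIT alias sums (S1b′'s `𝒫, 𝓋, 𝓌ᵀ` with the weights kept abstract)
  `capP κ l = Σ_m wQ_{mκ} (δ_{κl} − ∂_{mκ}∂♭_{ml}/L_m) wE_{ml} /(2L_m)`,  `capV κ = Σ_m wQ_{mκ} ∂_{mκ} wG_m /L_m²`,  `capW κ = Σ_m wM_m ∂♭_{mκ} wE_{mκ} /L_m²`,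
AND `A_m = Asol (feed g_m = f_m + wE_m ⊙ φ, gauge feed cc_m = γ_m + wG_m c)`, `μ_m = musol (g_m)` BY NAME (`Ablk`, `mublk`).  Ingredients: `arrow_of_cap`
(sufficiency: the per-block rows by `FibreBlockSolve.EL_row_Asol`/`G_row_Asol`, the global rows by the bookkeeping identities `sum_wQ_Ablk`, `sum_wM_mublk`),
`block_homog`/`block_unique` (per-block uniqueness: (EL)∧(G) force `Asol`/`musol` — the difference solves the homogeneous block, dot its (EL) with `∂♭_m`),
`cap_of_arrow` (necessity).  COROLLARY `arrow_injective_iff_cap_injective`: the homogeneous arrow system has only the trivial solution iff the homogeneous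
capacitance system does — the form in which an2's fibre bijectivity (`BlochFibreMatrix.det_fibreMatrix_blochChar_ne_zero`) will yield invertibility of the
concrete capacitance matrix at real `p ≠ 0` once leaf L04c identifies `fibreMatrix (blochChar p)` with the arrow system (part (b) of leaf P1-L05, NOT done here:
the concrete weights, `Cap N p`, `arrowMat_inv_apply`, the `p = 0` variant).
-/

open Finset
open scoped BigOperators

namespace Summit.QuantumFields.BalabanUV.Beta.GAN24.CapacitanceSolve

open FibreBlockSolve (dot dot_add_right dot_smul_right Asol musol dot_Asol G_row_Asol EL_row_Asol)

variable {D : ℕ} {ι : Type*}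

/-- [folklore] `dot` is compatible with subtraction in the second slot. -/
theorem dot_sub_right (u v w : Fin D → ℂ) : dot u (v - w) = dot u v - dot u w := by
  unfold dot; rw [← Finset.sum_sub_distrib]; exact Finset.sum_congr rfl fun κ _ => by rw [Pi.sub_apply]; ring

/-- [folklore] PER-FIBRE DATA of the arrow system over an abstract alias index `ι`: difference symbols `dd m = ∂̂(k_m)`, `db m = ∂̂♭(k_m)`, Laplacian symbols
`L m ≠ 0` with `∂̂♭_m·∂̂_m = L_m`, and the four border weight families (EL/φ, G/c, M/μ, Q/A). -/
structure Fibre (D : ℕ) (ι : Type*) where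
  /-- forward difference symbol `∂̂(k_m)` -/
  dd : ι → Fin D → ℂ
  /-- reflected difference symbol `∂̂♭(k_m)` -/
  db : ι → Fin D → ℂ
  /-- Laplacian symbol `L_m = |∂̂|²(k_m)` -/
  L : ι → ℂ
  /-- EL-row border weight: coefficient of `φ_κ` in EL row `(m, κ)` (S1a: `χ̂(m) s♭_κ(m)`) -/
  wE : ι → Fin D → ℂ
  /-- G-row border weight: coefficient of the block gauge constant `c` in G row `m` (S1a: `χ̂(m)`) -/
  wG : ι → ℂ
  /-- M-row weight of `μ̂(m)` (S1a: the box factor `S(m)`) -/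
  wM : ι → ℂ
  /-- Q-row weight of `Â_κ(m)` in Q row `κ` (S1a: `S(m) s_κ(m)`) -/
  wQ : ι → Fin D → ℂ
  /-- every block is away from the zero mode: `L_m ≠ 0` -/
  L_ne : ∀ m, L m ≠ 0
  /-- `∂̂♭_m · ∂̂_m = L_m` -/
  dot_db_dd : ∀ m, dot (db m) (dd m) = L m

variable (F : Fibre D ι)

/-! ## §1 The arrow system -/

/-- [shape] EL rows `(m, κ)`: `2(L_m A_{mκ} − ∂_{mκ}(∂♭_m·A_m)) − L_m ∂_{mκ} μ_m − wE_{mκ} φ_κ = f_{mκ}`.  Asserted of nothing. -/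
def ELRows (f : ι → Fin D → ℂ) (A : ι → Fin D → ℂ) (μ : ι → ℂ) (φ : Fin D → ℂ) : Prop :=
  ∀ m κ, 2 * (F.L m * A m κ - F.dd m κ * dot (F.db m) (A m)) - F.L m * F.dd m κ * μ m - F.wE m κ * φ κ = f m κ

/-- [shape] G rows `m`: `L_m (∂♭_m·A_m) − wG_m c = γ_m`.  Asserted of nothing. -/
def GRows (γ : ι → ℂ) (A : ι → Fin D → ℂ) (c : ℂ) : Prop :=
  ∀ m, F.L m * dot (F.db m) (A m) - F.wG m * c = γ m

/-- [shape] The M row: `Σ_m wM_m μ_m = ρ`.  Asserted of nothing. -/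
def MRow [Fintype ι] (ρ : ℂ) (μ : ι → ℂ) : Prop := ∑ m, F.wM m * μ m = ρ

/-- [shape] Q rows `κ`: `Σ_m wQ_{mκ} A_{mκ} = q_κ`.  Asserted of nothing. -/
def QRows [Fintype ι] (q : Fin D → ℂ) (A : ι → Fin D → ℂ) : Prop := ∀ κ, ∑ m, F.wQ m κ * A m κ = q κ

/-- [shape] THE ARROW SYSTEM with sources `(f, γ, ρ, q)` for the unknowns `(A, μ, φ, c)`.  Asserted of nothing. -/
def ArrowSolves [Fintype ι] (f : ι → Fin D → ℂ) (γ : ι → ℂ) (ρ : ℂ) (q : Fin D → ℂ)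
    (A : ι → Fin D → ℂ) (μ : ι → ℂ) (φ : Fin D → ℂ) (c : ℂ) : Prop :=
  ELRows F f A μ φ ∧ GRows F γ A c ∧ MRow F ρ μ ∧ QRows F q A

/-! ## §2 Feeds and the per-block solution BY NAME from `FibreBlockSolve` -/

/-- [folklore] The EL feed of block `m`: `g_m = f_m + wE_m ⊙ φ` (force plus constraint-multiplier feed). -/
def feed (f : ι → Fin D → ℂ) (φ : Fin D → ℂ) (m : ι) : Fin D → ℂ := fun κ => f m κ + F.wE m κ * φ κ

/-- [folklore] The gauge feed of block `m`: `cc_m = γ_m + wG_m c`. -/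
def gfeed (γ : ι → ℂ) (c : ℂ) (m : ι) : ℂ := γ m + F.wG m * c

/-- [folklore] The per-block field solution `A_m = Asol(∂_m, ∂♭_m, g_m, L_m, cc_m)`. -/
noncomputable def Ablk (f : ι → Fin D → ℂ) (γ : ι → ℂ) (φ : Fin D → ℂ) (c : ℂ) (m : ι) : Fin D → ℂ :=
  Asol (F.dd m) (F.db m) (feed F f φ m) (F.L m) (gfeed F γ c m)

/-- [folklore] The per-block gauge-multiplier solution `μ_m = musol(∂♭_m, g_m, L_m)` (independent of `c`). -/
noncomputable def mublk (f : ι → Fin D → ℂ) (φ : Fin D → ℂ) (m : ι) : ℂ := musol (F.db m) (feed F f φ m) (F.L m)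

/-! ## §3 The capacitance system: explicit alias sums -/

/-- [folklore] Summand of `capP`: `wQ_{mκ} (δ_{κl} − ∂_{mκ}∂♭_{ml}/L_m) wE_{ml} /(2L_m)` (Q-weight × transverse propagator × EL-weight). -/
noncomputable def capPm (m : ι) (κ l : Fin D) : ℂ :=
  F.wQ m κ * ((if κ = l then 1 else 0) - F.dd m κ * F.db m l / F.L m) * F.wE m l / (2 * F.L m)

/-- [folklore] `capP κ l = Σ_m capPm m κ l` — S1b′'s `𝒫` (the «pivot» `QGQ*` with the TRANSVERSE propagator `Π⊥/(2L)`). -/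
noncomputable def capP [Fintype ι] (κ l : Fin D) : ℂ := ∑ m, capPm F m κ l

/-- [folklore] `capV κ = Σ_m wQ_{mκ} ∂_{mκ} wG_m /L_m²` — S1b′'s `𝓋` (Q rows against the pure-gauge part of `Asol`). -/
noncomputable def capV [Fintype ι] (κ : Fin D) : ℂ := ∑ m, F.wQ m κ * F.dd m κ * F.wG m / F.L m ^ 2

/-- [folklore] `capW κ = Σ_m wM_m ∂♭_{mκ} wE_{mκ} /L_m²` — S1b′'s `𝓌ᵀ` (M row against `musol` of the constraint feed). -/
noncomputable def capW [Fintype ι] (κ : Fin D) : ℂ := ∑ m, F.wM m * F.db m κ * F.wE m κ / F.L m ^ 2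

/-- [folklore] Source term of the Q capacitance rows: `Σ_m wQ_{mκ} [(f_{mκ} − ∂_{mκ}(∂♭_m·f_m)/L_m)/(2L_m) + (γ_m/L_m²) ∂_{mκ}]`. -/
noncomputable def srcQ [Fintype ι] (f : ι → Fin D → ℂ) (γ : ι → ℂ) (κ : Fin D) : ℂ :=
  ∑ m, F.wQ m κ * ((f m κ - F.dd m κ * dot (F.db m) (f m) / F.L m) / (2 * F.L m) + γ m / F.L m ^ 2 * F.dd m κ)

/-- [folklore] Source term of the M capacitance row: `Σ_m wM_m (∂♭_m·f_m)/L_m²`. -/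
noncomputable def srcM [Fintype ι] (f : ι → Fin D → ℂ) : ℂ := ∑ m, F.wM m * dot (F.db m) (f m) / F.L m ^ 2

/-- [shape] THE CAPACITANCE SYSTEM `[[capP, capV],[capW, 0]] (φ; c) = (q − srcQ; −ρ − srcM)`.  Asserted of nothing. -/
def CapSolves [Fintype ι] (f : ι → Fin D → ℂ) (γ : ι → ℂ) (ρ : ℂ) (q : Fin D → ℂ) (φ : Fin D → ℂ) (c : ℂ) : Prop :=
  (∀ κ, ∑ l, capP F κ l * φ l + capV F κ * c = q κ - srcQ F f γ κ) ∧ (∑ κ, capW F κ * φ κ = -ρ - srcM F f)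

/-! ## §4 Bookkeeping identities -/

/-- [folklore] `∂♭_m · g_m = ∂♭_m · f_m + Σ_l ∂♭_{ml} wE_{ml} φ_l`. -/
theorem dot_feed (f : ι → Fin D → ℂ) (φ : Fin D → ℂ) (m : ι) :
    dot (F.db m) (feed F f φ m) = dot (F.db m) (f m) + ∑ l, F.db m l * F.wE m l * φ l := by
  unfold dot feed
  rw [← Finset.sum_add_distrib]
  exact Finset.sum_congr rfl fun l _ => by ring

/-- [folklore] ENTRYWISE FORM of the per-block solution: `f`/`γ`-part + `Σ_l (δ − ∂∂♭/L) wE/(2L) φ_l` + `(wG c/L²) ∂`. -/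
theorem Ablk_apply (f : ι → Fin D → ℂ) (γ : ι → ℂ) (φ : Fin D → ℂ) (c : ℂ) (m : ι) (κ : Fin D) :
    Ablk F f γ φ c m κ
      = ((f m κ - F.dd m κ * dot (F.db m) (f m) / F.L m) / (2 * F.L m) + γ m / F.L m ^ 2 * F.dd m κ)
        + ∑ l, ((if κ = l then 1 else 0) - F.dd m κ * F.db m l / F.L m) * F.wE m l / (2 * F.L m) * φ l
        + F.wG m * c / F.L m ^ 2 * F.dd m κ := by
  have hL := F.L_ne m
  simp only [Ablk, Asol, gfeed, dot_feed]
  have hsplit : ∑ l, ((if κ = l then 1 else 0) - F.dd m κ * F.db m l / F.L m) * F.wE m l / (2 * F.L m) * φ l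
      = (F.wE m κ * φ κ) / (2 * F.L m) - F.dd m κ * (∑ l, F.db m l * F.wE m l * φ l) / F.L m / (2 * F.L m) := by
    have h1 : ∀ l, ((if κ = l then 1 else 0) - F.dd m κ * F.db m l / F.L m) * F.wE m l / (2 * F.L m) * φ l
        = (if κ = l then F.wE m l * φ l / (2 * F.L m) else 0) - F.dd m κ * (F.db m l * F.wE m l * φ l) / F.L m / (2 * F.L m) := by
      intro l; split_ifs <;> ring
    simp only [h1, Finset.sum_sub_distrib, Finset.sum_ite_eq, Finset.mem_univ, if_true]
    rw [Finset.mul_sum, Finset.sum_div, Finset.sum_div]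
  rw [hsplit]
  simp only [feed]
  field_simp
  ring

/-- [folklore] **THE Q ROWS OF THE PER-BLOCK SOLUTION**: `Σ_m wQ_{mκ} (A_m)_κ = srcQ κ + Σ_l capP κ l φ_l + capV κ c`. -/
theorem sum_wQ_Ablk [Fintype ι] (f : ι → Fin D → ℂ) (γ : ι → ℂ) (φ : Fin D → ℂ) (c : ℂ) (κ : Fin D) :
    ∑ m, F.wQ m κ * Ablk F f γ φ c m κ = srcQ F f γ κ + ∑ l, capP F κ l * φ l + capV F κ * c := by
  have hP : ∑ l, capP F κ l * φ l
      = ∑ m, F.wQ m κ * ∑ l, ((if κ = l then 1 else 0) - F.dd m κ * F.db m l / F.L m) * F.wE m l / (2 * F.L m) * φ l := by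
    simp only [capP, capPm, Finset.sum_mul, Finset.mul_sum]
    rw [Finset.sum_comm]
    exact Finset.sum_congr rfl fun m _ => Finset.sum_congr rfl fun l _ => by ring
  have hV : capV F κ * c = ∑ m, F.wQ m κ * (F.wG m * c / F.L m ^ 2 * F.dd m κ) := by
    simp only [capV, Finset.sum_mul]
    exact Finset.sum_congr rfl fun m _ => by ring
  have hS : srcQ F f γ κ
      = ∑ m, F.wQ m κ * ((f m κ - F.dd m κ * dot (F.db m) (f m) / F.L m) / (2 * F.L m) + γ m / F.L m ^ 2 * F.dd m κ) := rfl
  rw [hP, hV, hS, ← Finset.sum_add_distrib, ← Finset.sum_add_distrib]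
  exact Finset.sum_congr rfl fun m _ => by rw [Ablk_apply]; ring

/-- [folklore] **THE M ROW OF THE PER-BLOCK SOLUTION**: `Σ_m wM_m μ_m = −srcM − Σ_κ capW κ φ_κ`. -/
theorem sum_wM_mublk [Fintype ι] (f : ι → Fin D → ℂ) (φ : Fin D → ℂ) :
    ∑ m, F.wM m * mublk F f φ m = -srcM F f - ∑ κ, capW F κ * φ κ := by
  have hW : ∑ κ, capW F κ * φ κ = ∑ m, ∑ κ, F.wM m * F.db m κ * F.wE m κ / F.L m ^ 2 * φ κ := by
    simp only [capW, Finset.sum_mul]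
    rw [Finset.sum_comm]
  rw [hW, srcM, ← Finset.sum_neg_distrib, ← Finset.sum_sub_distrib]
  refine Finset.sum_congr rfl fun m _ => ?_
  have h1 : ∑ κ, F.wM m * F.db m κ * F.wE m κ / F.L m ^ 2 * φ κ = F.wM m / F.L m ^ 2 * ∑ κ, F.db m κ * F.wE m κ * φ κ := by
    rw [Finset.mul_sum]
    exact Finset.sum_congr rfl fun κ _ => by ring
  rw [h1, mublk, musol, dot_feed]
  ring

/-! ## §5 Sufficiency: a capacitance solution generates an arrow solution -/

/-- [folklore] The per-block solution satisfies every EL row, for ANY `(φ, c)` (`FibreBlockSolve.EL_row_Asol` BY NAME). -/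
theorem elRows_Ablk (f : ι → Fin D → ℂ) (γ : ι → ℂ) (φ : Fin D → ℂ) (c : ℂ) :
    ELRows F f (Ablk F f γ φ c) (mublk F f φ) φ := by
  intro m κ
  have h := EL_row_Asol (F.dd m) (F.db m) (feed F f φ m) (F.L_ne m) (F.dot_db_dd m) (gfeed F γ c m) κ
  have hf : feed F f φ m κ = f m κ + F.wE m κ * φ κ := rfl
  unfold Ablk mublk
  linear_combination h + hf

/-- [folklore] The per-block solution satisfies every G row, for ANY `(φ, c)` (`FibreBlockSolve.G_row_Asol` BY NAME). -/
theorem gRows_Ablk (f : ι → Fin D → ℂ) (γ : ι → ℂ) (φ : Fin D → ℂ) (c : ℂ) :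
    GRows F γ (Ablk F f γ φ c) c := by
  intro m
  have h := G_row_Asol (F.dd m) (F.db m) (feed F f φ m) (F.L_ne m) (F.dot_db_dd m) (gfeed F γ c m)
  have hg : gfeed F γ c m = γ m + F.wG m * c := rfl
  unfold Ablk
  linear_combination h + hg

/-- [folklore] **SUFFICIENCY**: if `(φ, c)` solves the capacitance system then `(Ablk, mublk, φ, c)` solves the arrow system. -/
theorem arrow_of_cap [Fintype ι] {f : ι → Fin D → ℂ} {γ : ι → ℂ} {ρ : ℂ} {q : Fin D → ℂ} {φ : Fin D → ℂ} {c : ℂ}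
    (h : CapSolves F f γ ρ q φ c) : ArrowSolves F f γ ρ q (Ablk F f γ φ c) (mublk F f φ) φ c := by
  refine ⟨elRows_Ablk F f γ φ c, gRows_Ablk F f γ φ c, ?_, ?_⟩
  · -- M row
    unfold MRow
    rw [sum_wM_mublk, h.2]
    ring
  · -- Q rows
    intro κ
    rw [sum_wQ_Ablk, add_assoc, h.1 κ]
    ring

/-! ## §6 Per-block uniqueness and necessity -/

/-- [folklore] **THE HOMOGENEOUS BLOCK IS INJECTIVE**: if `2(L B_κ − ∂_κ(∂♭·B)) − L ∂_κ ν = 0` for all `κ` and `L (∂♭·B) = 0`, with `L ≠ 0`, `∂♭·∂ = L`, then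
`B = 0` and `ν = 0` (dot the EL rows with `∂♭`: `−L²ν = 0`; then `2L B_κ = 0`). -/
theorem block_homog (dd db B : Fin D → ℂ) {L : ℂ} (ν : ℂ) (hL : L ≠ 0) (hdd : dot db dd = L)
    (hEL : ∀ κ, 2 * (L * B κ - dd κ * dot db B) - L * dd κ * ν = 0) (hG : L * dot db B = 0) : B = 0 ∧ ν = 0 := by
  have hb : dot db B = 0 := by
    rcases mul_eq_zero.mp hG with h | h
    · exact absurd h hL
    · exact h
  have hsum : ∑ κ, db κ * (2 * (L * B κ - dd κ * dot db B) - L * dd κ * ν) = 0 :=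
    Finset.sum_eq_zero fun κ _ => by rw [hEL κ, mul_zero]
  have e : ∀ κ, db κ * (2 * (L * B κ - dd κ * dot db B) - L * dd κ * ν) = 2 * L * (db κ * B κ) - (2 * dot db B + L * ν) * (db κ * dd κ) := by
    intro κ; ring
  simp only [e, Finset.sum_sub_distrib, ← Finset.mul_sum] at hsum
  have h1 : ∑ κ, db κ * B κ = dot db B := rfl
  have h2 : ∑ κ, db κ * dd κ = dot db dd := rfl
  rw [h1, h2, hdd, hb] at hsum
  have hν : ν = 0 := by
    have h3 : L ^ 2 * ν = 0 := by linear_combination (-1 : ℂ) * hsum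
    exact (mul_eq_zero.mp h3).resolve_left (pow_ne_zero 2 hL)
  refine ⟨funext fun κ => ?_, hν⟩
  have hκ := hEL κ
  rw [hb, hν] at hκ
  have h4 : 2 * L * B κ = 0 := by linear_combination hκ
  exact (mul_eq_zero.mp h4).resolve_left (mul_ne_zero two_ne_zero hL)

/-- [folklore] **PER-BLOCK UNIQUENESS**: the (EL) rows of block `m` and its (G) row FORCE `μ_m = musol` and `A_m = Asol` (the difference with the
`FibreBlockSolve` solution solves the homogeneous block, `block_homog`). -/
theorem block_unique {f : ι → Fin D → ℂ} {γ : ι → ℂ} {A : ι → Fin D → ℂ} {μ : ι → ℂ} {φ : Fin D → ℂ} {c : ℂ}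
    (hEL : ELRows F f A μ φ) (hG : GRows F γ A c) (m : ι) :
    μ m = mublk F f φ m ∧ A m = Ablk F f γ φ c m := by
  have hB : ∀ κ, 2 * (F.L m * (A m - Ablk F f γ φ c m) κ - F.dd m κ * dot (F.db m) (A m - Ablk F f γ φ c m))
      - F.L m * F.dd m κ * (μ m - mublk F f φ m) = 0 := by
    intro κ
    have h1 := hEL m κ
    have h2 := elRows_Ablk F f γ φ c m κ
    rw [dot_sub_right, Pi.sub_apply]
    linear_combination h1 - h2
  have hGB : F.L m * dot (F.db m) (A m - Ablk F f γ φ c m) = 0 := by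
    have h1 := hG m
    have h2 := gRows_Ablk F f γ φ c m
    rw [dot_sub_right]
    linear_combination h1 - h2
  obtain ⟨hB0, hν0⟩ := block_homog (F.dd m) (F.db m) _ _ (F.L_ne m) (F.dot_db_dd m) hB hGB
  exact ⟨sub_eq_zero.mp hν0, sub_eq_zero.mp hB0⟩

/-- [folklore] **NECESSITY**: every solution of the arrow system is `(Ablk, mublk, φ, c)` with `(φ, c)` solving the capacitance system. -/
theorem cap_of_arrow [Fintype ι] {f : ι → Fin D → ℂ} {γ : ι → ℂ} {ρ : ℂ} {q : Fin D → ℂ}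
    {A : ι → Fin D → ℂ} {μ : ι → ℂ} {φ : Fin D → ℂ} {c : ℂ} (h : ArrowSolves F f γ ρ q A μ φ c) :
    CapSolves F f γ ρ q φ c ∧ A = Ablk F f γ φ c ∧ μ = mublk F f φ := by
  obtain ⟨hEL, hG, hM, hQ⟩ := h
  have hA : A = Ablk F f γ φ c := funext fun m => (block_unique F hEL hG m).2
  have hμ : μ = mublk F f φ := funext fun m => (block_unique F hEL hG m).1
  refine ⟨⟨fun κ => ?_, ?_⟩, hA, hμ⟩
  · have hq := hQ κ
    rw [hA, sum_wQ_Ablk] at hq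
    linear_combination hq
  · unfold MRow at hM
    rw [hμ, sum_wM_mublk] at hM
    linear_combination (-1 : ℂ) * hM

/-- [folklore] **THE CAPACITANCE REDUCTION** (S1b′): the arrow system is solved by `(A, μ, φ, c)` iff `(φ, c)` solves the `(D+1)×(D+1)` capacitance system and
`(A, μ)` are the explicit per-block formulas `Asol`/`musol` fed by `(φ, c)`. -/
theorem arrowSolves_iff [Fintype ι] (f : ι → Fin D → ℂ) (γ : ι → ℂ) (ρ : ℂ) (q : Fin D → ℂ)
    (A : ι → Fin D → ℂ) (μ : ι → ℂ) (φ : Fin D → ℂ) (c : ℂ) :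
    ArrowSolves F f γ ρ q A μ φ c ↔ CapSolves F f γ ρ q φ c ∧ A = Ablk F f γ φ c ∧ μ = mublk F f φ := by
  constructor
  · exact cap_of_arrow F
  · rintro ⟨hcap, rfl, rfl⟩
    exact arrow_of_cap F hcap

/-! ## §7 Homogeneous systems: injectivity transfers both ways -/

/-- [folklore] With zero sources and `(φ, c) = 0` the per-block solution vanishes. -/
theorem Ablk_zero (m : ι) : Ablk F 0 0 0 0 m = 0 := by
  funext κ
  simp [Ablk, Asol, feed, gfeed, dot]

/-- [folklore] With zero sources and `φ = 0` the per-block multiplier vanishes. -/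
theorem mublk_zero (m : ι) : mublk F 0 0 m = 0 := by
  simp [mublk, musol, feed, dot]

/-- [folklore] **INJECTIVITY TRANSFER**: the homogeneous arrow system has only the trivial solution iff the homogeneous capacitance system has only the
trivial solution.  (Leaf L05 part (b) feeds the left side from an2's `BlochFibreMatrix.det_fibreMatrix_blochChar_ne_zero` once L04c identifies the fibre
matrix with the arrow system; the right side is then the invertibility of the concrete capacitance matrix at real `p ≠ 0`.) -/
theorem arrow_injective_iff_cap_injective [Fintype ι] :
    (∀ A μ φ c, ArrowSolves F 0 0 0 0 A μ φ c → A = 0 ∧ μ = 0 ∧ φ = 0 ∧ c = 0)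
      ↔ (∀ φ c, CapSolves F 0 0 0 0 φ c → φ = 0 ∧ c = 0) := by
  constructor
  · intro h φ c hcap
    have := h _ _ φ c (arrow_of_cap F hcap)
    exact ⟨this.2.2.1, this.2.2.2⟩
  · intro h A μ φ c harr
    obtain ⟨hcap, hA, hμ⟩ := cap_of_arrow F harr
    obtain ⟨rfl, rfl⟩ := h φ c hcap
    refine ⟨?_, ?_, rfl, rfl⟩
    · rw [hA]; funext m; exact Ablk_zero F m
    · rw [hμ]; funext m; exact mublk_zero F m

end Summit.QuantumFields.BalabanUV.Beta.GAN24.CapacitanceSolve
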